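import Summits.ValiantsHypothesis.ValiantsHypothesis.Theorems.KPlusLogSqLawTridiagonalRealStaticPotentialRow

/-!
# Route «KPlusLogSqLaw», crux `WeakLifting` (stmt-ValiantsHypothesis-19561) — REAL side of the tridiagonal sector:
# the TWO-SIDED SPLITTING of the continuant and the CUT LAW for the zeros of three consecutive continuants

HONEST FRAMING.  Helper (`--supports stmt-ValiantsHypothesis-19561 --as helper`), seat val-sym-lift-p1 (g13), cell `pub-symmetroid`,
2026-08-28, on the REAL side of the desk's α target (lead R2102/R2114: the static DEFINITE symmetric tridiagonal monomial sector, UPPER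
side).  It proves NO upper law and the α register does not move.  What it adds is an exact, all-sizes STRUCTURE LAW in the continuant
currency `pathDet` of `…TridiagonalRealStaticPotentialDefs` (the currency of conjecture (P) and of the conditional upper row
`card_posRoots_le_of_potentialLawP`): where, relative to the OLDER continuants, the positive zeros of a continuant can sit.

WHAT IS PROVED (`D_k = pathDet a d b f k`; `D⁽ᵘ⁾_j` = the continuant of the design shifted by `u`, i.e. of the principal block on rows
`u, …, u + j − 1`; links `β_s = (b_s X^{f_s})²`).
1. `ctK_split` — the TWO-SIDED SPLITTING of the tree's continuant `ValuativeFlip.ctK` over any commutative ring: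
   `K_{s+2+n} = K_{s+1} · K⁽ˢ⁺¹⁾_{n+1} + M_s M'_{s+1} · K_s · K⁽ˢ⁺²⁾_n` (matchings either avoid the edge `{s, s+1}` or contain it); the tree had
   the two one-sided recurrences (`ctK_add_two`, `ctK_left`) and the zero-link case (`ctK_mul_shift`).
2. `pathDet_split_two_sided` — the same for the static symmetric tridiagonal monomial design:
   `D_{s+2+n} = D_{s+1} · D⁽ˢ⁺¹⁾_{n+1} − β_s · D_s · D⁽ˢ⁺²⁾_n`, and its evaluated form `eval_pathDet_split_two_sided`.
3. `mul_nonneg_at_root` / `mul_pos_at_root` — the COMPLEMENTARY-SIGN LAW: at every real zero `x` of `D_{s+2+n}`,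
   `D_s(x) · D_{s+1}(x) · D⁽ˢ⁺¹⁾_{n+1}(x) · D⁽ˢ⁺²⁾_n(x) = β_s(x) · (D_s(x) D⁽ˢ⁺²⁾_n(x))² ≥ 0`, strictly `> 0` when `b_s ≠ 0`, `x ≠ 0` and
   `D_s(x) · D⁽ˢ⁺²⁾_n(x) ≠ 0`: the `s`-th LDLᵀ pivot from the left and the complementary pivot from the right have the SAME SIGN at every zero
   of the determinant (for `n = 0`: consecutive continuants AGREE in sign at the zeros of the next one, `mul_pos_at_root_succ_succ`).
4. THE CUT LAW (`n = 1`, three consecutive levels; definite irreducible designs `0 < a`, `b ≠ 0`, `x > 0`): at a positive zero `x` of `D_{s+3}`,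
   `D_{s+1}(x) ≠ 0` (`eval_ne_zero_of_root_add_three`), `D_s(x) = 0 ↔ Δ(x) = 0` where
   `Δ = D⁽ˢ⁺¹⁾_2 = a_{s+1}a_{s+2} X^{d_{s+1}+d_{s+2}} − b_{s+1}² X^{2f_{s+1}}` is the trailing `2 × 2` minor (`eval_pathDet_shift_two`,
   `eval_eq_zero_iff_minor_eq_zero_at_root`), and `sign (D_s(x) D_{s+1}(x)) = sign Δ(x)` (`minor_neg_of_mul_neg_at_root`,
   `minor_pos_of_mul_pos_at_root`).  Since `Δ` is a two-term function with at most one sign change on `(0, ∞)` (`lt_of_twoTerm_neg_pos`),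
   **the positive zeros of `D_{s+3}` at which `D_s D_{s+1} < 0` and those at which `D_s D_{s+1} > 0` are SEPARATED** (`cut_law`): every zero of
   the first kind lies below every zero of the second kind when `2 f_{s+1} < d_{s+1} + d_{s+2}`, above when `2 f_{s+1} > d_{s+1} + d_{s+2}`, and
   the two kinds do not coexist when the exponents tie.  In the language of conjecture (P): the new letters of `rootWord D_{s+2} D_{s+3}` fall
   into the cells of the OLDER word `rootWord D_s D_{s+1}` of disagreeing sign on one side of a single cut point and into its cells of
   agreeing sign on the other side — a constraint on three consecutive root words that every step `(P)_k` may use.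
Nothing here bears on `WeakLifting` / `TropicalB` (stmt-19771) in their windows, on Conjecture B, on the Door-A registers, on
`MatrixDescartes` (stmt-ValiantsHypothesis-18050) or on VP ≠ VNP.
[folklore: continuants (two-sided expansion of a tridiagonal determinant along an edge); the sign/cut statements are this seat's bookkeeping]
-/

-- `Summit.ValiantsHypothesis.ValiantsHypothesis.…` repeats a component by the D-0017 layout (single-conjunct summit); the name is mandated.
set_option linter.dupNamespace false
set_option autoImplicit false

namespace Summit.ValiantsHypothesis.ValiantsHypothesis.Theorems.KPlusLogSqLaw

namespace StaticTridiagonalRealCut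

open Polynomial
open Summit.ValiantsHypothesis.ValiantsHypothesis.Theorems.ValuativeFlip (ctK ctK_zero ctK_one ctK_add_two ctK_congr)
open Summit.ValiantsHypothesis.ValiantsHypothesis.Theorems.KPlusLogSqLaw.StaticTridiagonalReal (det_ctPath)
open Summit.ValiantsHypothesis.ValiantsHypothesis.Theorems.KPlusLogSqLaw.StaticTridiagonalRealPotential
  (pathDet pathDet_zero pathDet_one pathDet_add_two eval_pathDet_succ_ne_zero)

/-! ### §1 Two-sided splitting of the continuant over a commutative ring -/

section Ring

variable {R : Type*} [CommRing R]

/-- **Two-sided splitting of the continuant** along the edge `{s, s+1}`: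
`K_{s+2+n} = K_{s+1} · K⁽ˢ⁺¹⁾_{n+1} + M_s · M'_{s+1} · K_s · K⁽ˢ⁺²⁾_n`, where `K⁽ᵘ⁾` is the continuant of the data shifted by `u`.
[folklore: continuants] -/
theorem ctK_split (L M M' : ℕ → R) (s : ℕ) :
    ∀ n : ℕ, ctK L M M' (s + 2 + n) =
      ctK L M M' (s + 1) *
          ctK (fun t => L (t + (s + 1))) (fun t => M (t + (s + 1))) (fun t => M' (t + (s + 1))) (n + 1) +
        M s * M' (s + 1) * ctK L M M' s *
          ctK (fun t => L (t + (s + 2))) (fun t => M (t + (s + 2))) (fun t => M' (t + (s + 2))) n := by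
  intro n
  induction n using Nat.strong_induction_on with
  | _ n ih =>
    rcases n with _ | _ | n
    · rw [show s + 2 + 0 = s + 2 by ring, ctK_add_two, show (0 : ℕ) + 1 = 0 + 1 from rfl, ctK_one, ctK_zero]
      simp only [zero_add]
      ring
    · rw [show s + 2 + (0 + 1) = (s + 1) + 2 by ring, ctK_add_two, ctK_add_two, ctK_add_two, ctK_one, ctK_zero, ctK_one]
      simp only [zero_add, show s + 1 + 1 = s + 2 by ring, show 1 + (s + 1) = s + 2 by ring]
      ring
    · have e1 := ih (n + 1) (by omega)
      have e0 := ih n (by omega)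
      rw [show s + 2 + (n + 1 + 1) = (s + 2 + n) + 2 by ring, ctK_add_two,
        show s + 2 + n + 1 = s + 2 + (n + 1) by ring, e1, e0,
        show n + 1 + 1 + 1 = (n + 1) + 2 by ring,
        ctK_add_two (fun t => L (t + (s + 1))) (fun t => M (t + (s + 1))) (fun t => M' (t + (s + 1))) (n + 1),
        show n + 1 + 1 = n + 2 by ring,
        ctK_add_two (fun t => L (t + (s + 2))) (fun t => M (t + (s + 2))) (fun t => M' (t + (s + 2))) n]
      simp only [show n + 2 + (s + 1) = s + 2 + (n + 1) by ring, show n + 1 + (s + 1) = s + 2 + n by ring,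
        show n + 1 + (s + 2) = s + 2 + (n + 1) by ring, show n + (s + 2) = s + 2 + n by ring]
      ring

end Ring

/-! ### §2 The splitting in the continuant currency `pathDet` and its evaluated form -/

variable (a : ℕ → ℝ) (d : ℕ → ℕ) (b : ℕ → ℝ) (f : ℕ → ℕ)

/-- **Two-sided splitting of the static symmetric tridiagonal continuant** along the edge `{s, s+1}`:
`D_{s+2+n} = D_{s+1} · D⁽ˢ⁺¹⁾_{n+1} − (b_s X^{f_s})² · D_s · D⁽ˢ⁺²⁾_n`. [folklore: continuants] -/
theorem pathDet_split_two_sided (s n : ℕ) :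
    pathDet a d b f (s + 2 + n) =
      pathDet a d b f (s + 1) *
          pathDet (fun t => a (t + (s + 1))) (fun t => d (t + (s + 1))) (fun t => b (t + (s + 1)))
            (fun t => f (t + (s + 1))) (n + 1) -
        (C (b s) * X ^ f s) ^ 2 * pathDet a d b f s *
          pathDet (fun t => a (t + (s + 2))) (fun t => d (t + (s + 2))) (fun t => b (t + (s + 2)))
            (fun t => f (t + (s + 2))) n := by
  unfold pathDet
  rw [det_ctPath _ _ _ (s + 2 + n), det_ctPath _ _ _ (s + 1), det_ctPath _ _ _ s, det_ctPath _ _ _ (n + 1),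
    det_ctPath _ _ _ n, ctK_split _ _ _ s n]
  have h1 : ctK (fun t => C (a (t + (s + 1))) * X ^ d (t + (s + 1)))
      (fun t => -(C (b (t + (s + 1))) * X ^ f (t + (s + 1))))
      (fun t => C (b (t + (s + 1) - 1)) * X ^ f (t + (s + 1) - 1)) (n + 1) =
      ctK (fun t => C (a (t + (s + 1))) * X ^ d (t + (s + 1)))
      (fun t => -(C (b (t + (s + 1))) * X ^ f (t + (s + 1))))
      (fun t => C (b (t - 1 + (s + 1))) * X ^ f (t - 1 + (s + 1))) (n + 1) :=
    ctK_congr (n + 1) (fun t _ => rfl) (fun t _ => rfl) (fun t h1 _ => by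
      simp only [show t + (s + 1) - 1 = t - 1 + (s + 1) by omega])
  have h2 : ctK (fun t => C (a (t + (s + 2))) * X ^ d (t + (s + 2)))
      (fun t => -(C (b (t + (s + 2))) * X ^ f (t + (s + 2))))
      (fun t => C (b (t + (s + 2) - 1)) * X ^ f (t + (s + 2) - 1)) n =
      ctK (fun t => C (a (t + (s + 2))) * X ^ d (t + (s + 2)))
      (fun t => -(C (b (t + (s + 2))) * X ^ f (t + (s + 2))))
      (fun t => C (b (t - 1 + (s + 2))) * X ^ f (t - 1 + (s + 2))) n :=
    ctK_congr n (fun t _ => rfl) (fun t _ => rfl) (fun t h1 _ => by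
      simp only [show t + (s + 2) - 1 = t - 1 + (s + 2) by omega])
  rw [h1, h2]
  simp only [Nat.add_sub_cancel]
  ring

/-- Evaluated form of the two-sided splitting at a real point `x`. [folklore] -/
theorem eval_pathDet_split_two_sided (s n : ℕ) (x : ℝ) :
    (pathDet a d b f (s + 2 + n)).eval x =
      (pathDet a d b f (s + 1)).eval x *
          (pathDet (fun t => a (t + (s + 1))) (fun t => d (t + (s + 1))) (fun t => b (t + (s + 1)))
            (fun t => f (t + (s + 1))) (n + 1)).eval x -
        (b s * x ^ f s) ^ 2 * (pathDet a d b f s).eval x *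
          (pathDet (fun t => a (t + (s + 2))) (fun t => d (t + (s + 2))) (fun t => b (t + (s + 2)))
            (fun t => f (t + (s + 2))) n).eval x := by
  rw [pathDet_split_two_sided]
  simp only [eval_sub, eval_mul, eval_pow, eval_C, eval_X]

/-! ### §3 The complementary-sign law at the zeros of the determinant -/

/-- **Complementary-sign law (product form).**  At a real zero `x` of `D_{s+2+n}`:
`D_s(x) · D_{s+1}(x) · D⁽ˢ⁺¹⁾_{n+1}(x) · D⁽ˢ⁺²⁾_n(x) = (b_s x^{f_s})² · (D_s(x) · D⁽ˢ⁺²⁾_n(x))²`; in particular it is `≥ 0`: the `s`-th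
pivot `D_{s+1}/D_s` from the left and the complementary pivot `D⁽ˢ⁺¹⁾_{n+1}/D⁽ˢ⁺²⁾_n` from the right never have opposite signs at a zero
of the determinant. [this file; folklore bookkeeping] -/
theorem mul_eq_sq_at_root (s n : ℕ) (x : ℝ) (hroot : (pathDet a d b f (s + 2 + n)).eval x = 0) :
    (pathDet a d b f s).eval x * (pathDet a d b f (s + 1)).eval x *
        (pathDet (fun t => a (t + (s + 1))) (fun t => d (t + (s + 1))) (fun t => b (t + (s + 1)))
          (fun t => f (t + (s + 1))) (n + 1)).eval x *
        (pathDet (fun t => a (t + (s + 2))) (fun t => d (t + (s + 2))) (fun t => b (t + (s + 2)))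
          (fun t => f (t + (s + 2))) n).eval x =
      (b s * x ^ f s) ^ 2 *
        ((pathDet a d b f s).eval x *
          (pathDet (fun t => a (t + (s + 2))) (fun t => d (t + (s + 2))) (fun t => b (t + (s + 2)))
            (fun t => f (t + (s + 2))) n).eval x) ^ 2 := by
  rw [eval_pathDet_split_two_sided] at hroot
  have h := sub_eq_zero.1 hroot
  -- `D_{s+1} · D⁽ˢ⁺¹⁾ = β · D_s · D⁽ˢ⁺²⁾`; multiply by `D_s · D⁽ˢ⁺²⁾`
  calc _ = ((pathDet a d b f (s + 1)).eval x *
        (pathDet (fun t => a (t + (s + 1))) (fun t => d (t + (s + 1))) (fun t => b (t + (s + 1)))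
          (fun t => f (t + (s + 1))) (n + 1)).eval x) *
        ((pathDet a d b f s).eval x *
          (pathDet (fun t => a (t + (s + 2))) (fun t => d (t + (s + 2))) (fun t => b (t + (s + 2)))
            (fun t => f (t + (s + 2))) n).eval x) := by ring
    _ = _ := by rw [h]; ring

/-- **Complementary-sign law**: at a real zero of `D_{s+2+n}` the product `D_s · D_{s+1} · D⁽ˢ⁺¹⁾_{n+1} · D⁽ˢ⁺²⁾_n` is non-negative.
[this file] -/
theorem mul_nonneg_at_root (s n : ℕ) (x : ℝ) (hroot : (pathDet a d b f (s + 2 + n)).eval x = 0) :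
    0 ≤ (pathDet a d b f s).eval x * (pathDet a d b f (s + 1)).eval x *
        (pathDet (fun t => a (t + (s + 1))) (fun t => d (t + (s + 1))) (fun t => b (t + (s + 1)))
          (fun t => f (t + (s + 1))) (n + 1)).eval x *
        (pathDet (fun t => a (t + (s + 2))) (fun t => d (t + (s + 2))) (fun t => b (t + (s + 2)))
          (fun t => f (t + (s + 2))) n).eval x := by
  rw [mul_eq_sq_at_root a d b f s n x hroot]
  positivity

/-- **Complementary-sign law, strict form**: if moreover `b_s ≠ 0`, `x ≠ 0` and `D_s(x) · D⁽ˢ⁺²⁾_n(x) ≠ 0`, the product is positive —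
the two complementary pivots have the SAME sign. [this file] -/
theorem mul_pos_at_root (s n : ℕ) (x : ℝ) (hb : b s ≠ 0) (hx : x ≠ 0)
    (hroot : (pathDet a d b f (s + 2 + n)).eval x = 0)
    (hne : (pathDet a d b f s).eval x *
      (pathDet (fun t => a (t + (s + 2))) (fun t => d (t + (s + 2))) (fun t => b (t + (s + 2)))
        (fun t => f (t + (s + 2))) n).eval x ≠ 0) :
    0 < (pathDet a d b f s).eval x * (pathDet a d b f (s + 1)).eval x *
        (pathDet (fun t => a (t + (s + 1))) (fun t => d (t + (s + 1))) (fun t => b (t + (s + 1)))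
          (fun t => f (t + (s + 1))) (n + 1)).eval x *
        (pathDet (fun t => a (t + (s + 2))) (fun t => d (t + (s + 2))) (fun t => b (t + (s + 2)))
          (fun t => f (t + (s + 2))) n).eval x := by
  rw [mul_eq_sq_at_root a d b f s n x hroot]
  have hβ : 0 < (b s * x ^ f s) ^ 2 := by
    have : b s * x ^ f s ≠ 0 := mul_ne_zero hb (pow_ne_zero _ hx)
    positivity
  exact mul_pos hβ (by positivity)

/-- The case `n = 0`: **consecutive continuants agree in sign at the positive zeros of the next one** — for an irreducible design
(`b ≠ 0`) and `x > 0`, `D_{s+2}(x) = 0 ⇒ 0 < D_s(x) · D_{s+1}(x)`. [folklore; this file] -/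
theorem mul_pos_at_root_succ_succ (ha : ∀ t, 0 < a t) (hb : ∀ t, b t ≠ 0) (s : ℕ) {x : ℝ} (hx : 0 < x)
    (hroot : (pathDet a d b f (s + 2)).eval x = 0) :
    0 < (pathDet a d b f s).eval x * (pathDet a d b f (s + 1)).eval x := by
  have hroot' : (pathDet a d b f (s + 2 + 0)).eval x = 0 := by simpa using hroot
  have hDs : (pathDet a d b f s).eval x ≠ 0 := fun h0 =>
    eval_pathDet_succ_ne_zero a d b f hb hx s h0 (by
      -- `D_{s+1}(x) = 0` as well would contradict; derive `D_{s+1}(x) = 0` from the recurrence? No: we show `D_{s+1}(x) ≠ 0` is not needed;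
      -- instead: `D_s(x) = 0` and `D_{s+2}(x) = 0` force `a_{s+1} x^{d} D_{s+1}(x) = 0`, hence `D_{s+1}(x) = 0`.
      have h2 := hroot
      rw [pathDet_add_two] at h2
      simp only [eval_sub, eval_mul, eval_pow, eval_C, eval_X, h0, mul_zero, sub_zero] at h2
      rcases mul_eq_zero.1 h2 with h | h
      · exact absurd h (mul_ne_zero (ha _).ne' (pow_ne_zero _ hx.ne'))
      · exact h)
  have h1 : (pathDet (fun t => a (t + (s + 2))) (fun t => d (t + (s + 2))) (fun t => b (t + (s + 2)))
      (fun t => f (t + (s + 2))) 0).eval x = 1 := by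
    rw [pathDet_zero]; simp
  have h2 : (pathDet (fun t => a (t + (s + 1))) (fun t => d (t + (s + 1))) (fun t => b (t + (s + 1)))
      (fun t => f (t + (s + 1))) (0 + 1)).eval x = a (s + 1) * x ^ d (s + 1) := by
    rw [show (0 : ℕ) + 1 = 1 from rfl, pathDet_one]; simp
  have key := mul_pos_at_root a d b f s 0 x (hb s) hx.ne' hroot' (by rw [h1, mul_one]; exact hDs)
  rw [h1, h2, mul_one] at key
  have hpos : 0 < a (s + 1) * x ^ d (s + 1) := mul_pos (ha _) (pow_pos hx _)
  -- key : 0 < D_s D_{s+1} * (a x^d)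
  by_contra hle
  push Not at hle
  have : (pathDet a d b f s).eval x * (pathDet a d b f (s + 1)).eval x * (a (s + 1) * x ^ d (s + 1)) ≤ 0 :=
    mul_nonpos_of_nonpos_of_nonneg hle hpos.le
  linarith

/-! ### §4 The cut law (three consecutive levels) -/

/-- The trailing `2 × 2` minor: `D⁽ˢ⁺¹⁾_2(x) = a_{s+1} a_{s+2} x^{d_{s+1}+d_{s+2}} − b_{s+1}² x^{2 f_{s+1}}`. [folklore] -/
theorem eval_pathDet_shift_two (s : ℕ) (x : ℝ) :
    (pathDet (fun t => a (t + (s + 1))) (fun t => d (t + (s + 1))) (fun t => b (t + (s + 1)))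
        (fun t => f (t + (s + 1))) 2).eval x =
      a (s + 1) * a (s + 2) * x ^ (d (s + 1) + d (s + 2)) - b (s + 1) ^ 2 * x ^ (2 * f (s + 1)) := by
  rw [show (2 : ℕ) = 0 + 2 from rfl, pathDet_add_two, pathDet_one, pathDet_zero]
  simp only [eval_sub, eval_mul, eval_pow, eval_C, eval_X, eval_one, zero_add,
    show 1 + (s + 1) = s + 2 by ring]
  ring

/-- At a positive zero of `D_{s+3}` of a definite irreducible design, `D_{s+1}(x) ≠ 0`. [this file] -/
theorem eval_ne_zero_of_root_add_three (ha : ∀ t, 0 < a t) (hb : ∀ t, b t ≠ 0) (s : ℕ) {x : ℝ} (hx : 0 < x)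
    (hroot : (pathDet a d b f (s + 3)).eval x = 0) :
    (pathDet a d b f (s + 1)).eval x ≠ 0 := by
  intro h1
  -- `D_{s+3} = a X^d D_{s+2} − β D_{s+1}`, so `D_{s+2}(x) = 0`, contradicting `eval_pathDet_succ_ne_zero` at level `s+1`.
  have h3 := hroot
  rw [show s + 3 = (s + 1) + 2 by ring, pathDet_add_two] at h3
  simp only [eval_sub, eval_mul, eval_pow, eval_C, eval_X, h1, mul_zero, sub_zero] at h3
  rcases mul_eq_zero.1 h3 with h | h
  · exact absurd h (mul_ne_zero (ha _).ne' (pow_ne_zero _ hx.ne'))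
  · exact eval_pathDet_succ_ne_zero a d b f hb hx (s + 1) h1 h

/-- The cut identity at a zero of `D_{s+3}` (`n = 1` of `mul_eq_sq_at_root`, with the positive last factor `a_{s+2} x^{d_{s+2}}`):
`D_s(x) · D_{s+1}(x) · Δ(x) · (a_{s+2} x^{d_{s+2}}) = (b_s x^{f_s})² · (D_s(x) · a_{s+2} x^{d_{s+2}})²`. [this file] -/
theorem cut_identity (s : ℕ) (x : ℝ) (hroot : (pathDet a d b f (s + 3)).eval x = 0) :
    (pathDet a d b f s).eval x * (pathDet a d b f (s + 1)).eval x *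
        (a (s + 1) * a (s + 2) * x ^ (d (s + 1) + d (s + 2)) - b (s + 1) ^ 2 * x ^ (2 * f (s + 1))) *
        (a (s + 2) * x ^ d (s + 2)) =
      (b s * x ^ f s) ^ 2 * ((pathDet a d b f s).eval x * (a (s + 2) * x ^ d (s + 2))) ^ 2 := by
  have hroot' : (pathDet a d b f (s + 2 + 1)).eval x = 0 := by rw [show s + 2 + 1 = s + 3 by ring]; exact hroot
  have key := mul_eq_sq_at_root a d b f s 1 x hroot'
  have h2 : (pathDet (fun t => a (t + (s + 2))) (fun t => d (t + (s + 2))) (fun t => b (t + (s + 2)))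
      (fun t => f (t + (s + 2))) 1).eval x = a (s + 2) * x ^ d (s + 2) := by
    rw [pathDet_one]; simp
  rw [show (1 : ℕ) + 1 = 2 from rfl, eval_pathDet_shift_two, h2] at key
  exact key

/-- At a positive zero `x` of `D_{s+3}` (definite irreducible design): `D_s(x) = 0 ↔ Δ(x) = 0` — the `s`-th leading continuant vanishes
exactly when the trailing `2 × 2` minor does. [this file] -/
theorem eval_eq_zero_iff_minor_eq_zero_at_root (ha : ∀ t, 0 < a t) (hb : ∀ t, b t ≠ 0) (s : ℕ) {x : ℝ} (hx : 0 < x)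
    (hroot : (pathDet a d b f (s + 3)).eval x = 0) :
    (pathDet a d b f s).eval x = 0 ↔
      a (s + 1) * a (s + 2) * x ^ (d (s + 1) + d (s + 2)) - b (s + 1) ^ 2 * x ^ (2 * f (s + 1)) = 0 := by
  have hD1 := eval_ne_zero_of_root_add_three a d b f ha hb s hx hroot
  have hroot' : (pathDet a d b f (s + 2 + 1)).eval x = 0 := by rw [show s + 2 + 1 = s + 3 by ring]; exact hroot
  -- the splitting at the root: `D_{s+1} Δ = β D_s · a_{s+2} x^{d_{s+2}}`
  have h := eval_pathDet_split_two_sided a d b f s 1 x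
  rw [hroot', show (1 : ℕ) + 1 = 2 from rfl, eval_pathDet_shift_two, pathDet_one] at h
  simp only [eval_mul, eval_pow, eval_C, eval_X, zero_add] at h
  have hpos : 0 < a (s + 2) * x ^ d (s + 2) := mul_pos (ha _) (pow_pos hx _)
  have hβ : (b s * x ^ f s) ^ 2 ≠ 0 := pow_ne_zero _ (mul_ne_zero (hb s) (pow_ne_zero _ hx.ne'))
  constructor
  · intro h0
    rw [h0, mul_zero, zero_mul, sub_zero] at h
    rcases mul_eq_zero.1 h.symm with h' | h'
    · exact absurd h' hD1
    · exact h'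
  · intro hΔ
    rw [hΔ, mul_zero, zero_sub] at h
    have h' : (b s * x ^ f s) ^ 2 * (pathDet a d b f s).eval x * (a (s + 2) * x ^ d (s + 2)) = 0 := by linarith
    rcases mul_eq_zero.1 h' with h'' | h''
    · rcases mul_eq_zero.1 h'' with h3 | h3
      · exact absurd h3 hβ
      · exact h3
    · exact absurd h'' hpos.ne'

/-- **CUT LAW, negative side**: at a positive zero `x` of `D_{s+3}` with `D_s(x) · D_{s+1}(x) < 0`, the trailing `2 × 2` minor is
negative, `Δ(x) < 0`. [this file] -/
theorem minor_neg_of_mul_neg_at_root (ha : ∀ t, 0 < a t) (hb : ∀ t, b t ≠ 0) (s : ℕ) {x : ℝ} (hx : 0 < x)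
    (hroot : (pathDet a d b f (s + 3)).eval x = 0)
    (hneg : (pathDet a d b f s).eval x * (pathDet a d b f (s + 1)).eval x < 0) :
    a (s + 1) * a (s + 2) * x ^ (d (s + 1) + d (s + 2)) - b (s + 1) ^ 2 * x ^ (2 * f (s + 1)) < 0 := by
  have key := cut_identity a d b f s x hroot
  have hpos : 0 < a (s + 2) * x ^ d (s + 2) := mul_pos (ha _) (pow_pos hx _)
  have hDs : (pathDet a d b f s).eval x ≠ 0 := fun h => by rw [h, zero_mul] at hneg; exact lt_irrefl _ hneg
  have hrhs : 0 < (b s * x ^ f s) ^ 2 * ((pathDet a d b f s).eval x * (a (s + 2) * x ^ d (s + 2))) ^ 2 := by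
    have h1 : b s * x ^ f s ≠ 0 := mul_ne_zero (hb s) (pow_ne_zero _ hx.ne')
    have h2 : (pathDet a d b f s).eval x * (a (s + 2) * x ^ d (s + 2)) ≠ 0 := mul_ne_zero hDs hpos.ne'
    positivity
  by_contra hge
  push Not at hge
  -- LHS ≤ 0 < RHS
  have : (pathDet a d b f s).eval x * (pathDet a d b f (s + 1)).eval x *
      (a (s + 1) * a (s + 2) * x ^ (d (s + 1) + d (s + 2)) - b (s + 1) ^ 2 * x ^ (2 * f (s + 1))) *
      (a (s + 2) * x ^ d (s + 2)) ≤ 0 :=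
    mul_nonpos_of_nonpos_of_nonneg (mul_nonpos_of_nonpos_of_nonneg hneg.le hge) hpos.le
  linarith

/-- **CUT LAW, positive side**: at a positive zero `x` of `D_{s+3}` with `D_s(x) · D_{s+1}(x) > 0`, the trailing `2 × 2` minor is
positive, `Δ(x) > 0`. [this file] -/
theorem minor_pos_of_mul_pos_at_root (ha : ∀ t, 0 < a t) (hb : ∀ t, b t ≠ 0) (s : ℕ) {x : ℝ} (hx : 0 < x)
    (hroot : (pathDet a d b f (s + 3)).eval x = 0)
    (hposD : 0 < (pathDet a d b f s).eval x * (pathDet a d b f (s + 1)).eval x) :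
    0 < a (s + 1) * a (s + 2) * x ^ (d (s + 1) + d (s + 2)) - b (s + 1) ^ 2 * x ^ (2 * f (s + 1)) := by
  have key := cut_identity a d b f s x hroot
  have hpos : 0 < a (s + 2) * x ^ d (s + 2) := mul_pos (ha _) (pow_pos hx _)
  have hDs : (pathDet a d b f s).eval x ≠ 0 := fun h => by rw [h, zero_mul] at hposD; exact lt_irrefl _ hposD
  have hrhs : 0 < (b s * x ^ f s) ^ 2 * ((pathDet a d b f s).eval x * (a (s + 2) * x ^ d (s + 2))) ^ 2 := by
    have h1 : b s * x ^ f s ≠ 0 := mul_ne_zero (hb s) (pow_ne_zero _ hx.ne')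
    have h2 : (pathDet a d b f s).eval x * (a (s + 2) * x ^ d (s + 2)) ≠ 0 := mul_ne_zero hDs hpos.ne'
    positivity
  by_contra hle
  push Not at hle
  have : (pathDet a d b f s).eval x * (pathDet a d b f (s + 1)).eval x *
      (a (s + 1) * a (s + 2) * x ^ (d (s + 1) + d (s + 2)) - b (s + 1) ^ 2 * x ^ (2 * f (s + 1))) *
      (a (s + 2) * x ^ d (s + 2)) ≤ 0 :=
    mul_nonpos_of_nonpos_of_nonneg (mul_nonpos_of_nonneg_of_nonpos hposD.le hle) hpos.le
  linarith

/-- A two-term function `A x^p − B x^q` (`A, B > 0`) changes sign at most once on `(0, ∞)`, in the direction dictated by the exponents: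
if it is negative at `ξ > 0` and positive at `η > 0` then `q < p ∧ ξ < η` or `p < q ∧ η < ξ`. [folklore] -/
theorem lt_of_twoTerm_neg_pos {A B ξ η : ℝ} {p q : ℕ} (hA : 0 < A) (hB : 0 < B) (hξ : 0 < ξ) (hη : 0 < η)
    (hneg : A * ξ ^ p - B * ξ ^ q < 0) (hpos : 0 < A * η ^ p - B * η ^ q) :
    (q < p ∧ ξ < η) ∨ (p < q ∧ η < ξ) := by
  rcases lt_trichotomy q p with hqp | hqp | hqp
  · refine Or.inl ⟨hqp, ?_⟩
    obtain ⟨k, hk⟩ : ∃ k, p = q + k := ⟨p - q, by omega⟩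
    subst hk
    rw [pow_add, show A * (ξ ^ q * ξ ^ k) - B * ξ ^ q = ξ ^ q * (A * ξ ^ k - B) by ring] at hneg
    rw [pow_add, show A * (η ^ q * η ^ k) - B * η ^ q = η ^ q * (A * η ^ k - B) by ring] at hpos
    have h1 : A * ξ ^ k - B < 0 := neg_of_mul_neg_right hneg (pow_pos hξ q).le
    have h2 : 0 < A * η ^ k - B := (mul_pos_iff_of_pos_left (pow_pos hη q)).1 hpos
    exact lt_of_pow_lt_pow_left₀ k hη.le (lt_of_mul_lt_mul_left (by linarith : A * ξ ^ k < A * η ^ k) hA.le)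
  · exfalso
    subst hqp
    have h1 : (A - B) * ξ ^ q < 0 := by linarith
    have h2 : 0 < (A - B) * η ^ q := by linarith
    have h3 : A - B < 0 := neg_of_mul_neg_left h1 (pow_pos hξ q).le
    have h4 : 0 < A - B := (mul_pos_iff_of_pos_right (pow_pos hη q)).1 h2
    linarith
  · refine Or.inr ⟨hqp, ?_⟩
    obtain ⟨k, hk⟩ : ∃ k, q = p + k := ⟨q - p, by omega⟩
    subst hk
    rw [pow_add, show A * ξ ^ p - B * (ξ ^ p * ξ ^ k) = ξ ^ p * (A - B * ξ ^ k) by ring] at hneg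
    rw [pow_add, show A * η ^ p - B * (η ^ p * η ^ k) = η ^ p * (A - B * η ^ k) by ring] at hpos
    have h1 : A - B * ξ ^ k < 0 := neg_of_mul_neg_right hneg (pow_pos hξ p).le
    have h2 : 0 < A - B * η ^ k := (mul_pos_iff_of_pos_left (pow_pos hη p)).1 hpos
    exact lt_of_pow_lt_pow_left₀ k hξ.le (lt_of_mul_lt_mul_left (by linarith : B * η ^ k < B * ξ ^ k) hB.le)

/-- **THE CUT LAW.**  For a static DEFINITE (`0 < a`) symmetric tridiagonal monomial design with NONZERO links (`b ≠ 0`) and any `s`: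
if `ξ, η > 0` are zeros of `D_{s+3}` with `D_s(ξ) D_{s+1}(ξ) < 0 < D_s(η) D_{s+1}(η)` — `ξ` lies in a cell of the older root word
`rootWord D_s D_{s+1}` where the two continuants DISAGREE in sign, `η` in one where they AGREE — then
`2 f_{s+1} < d_{s+1} + d_{s+2}` and `ξ < η`, or `d_{s+1} + d_{s+2} < 2 f_{s+1}` and `η < ξ`: the two kinds of zeros are separated by the
unique sign change of the trailing `2 × 2` minor, and they cannot coexist when its two exponents tie. [this file] -/
theorem cut_law (ha : ∀ t, 0 < a t) (hb : ∀ t, b t ≠ 0) (s : ℕ) {ξ η : ℝ} (hξ : 0 < ξ) (hη : 0 < η)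
    (hrootξ : (pathDet a d b f (s + 3)).eval ξ = 0) (hrootη : (pathDet a d b f (s + 3)).eval η = 0)
    (hneg : (pathDet a d b f s).eval ξ * (pathDet a d b f (s + 1)).eval ξ < 0)
    (hpos : 0 < (pathDet a d b f s).eval η * (pathDet a d b f (s + 1)).eval η) :
    (2 * f (s + 1) < d (s + 1) + d (s + 2) ∧ ξ < η) ∨ (d (s + 1) + d (s + 2) < 2 * f (s + 1) ∧ η < ξ) := by
  have h1 := minor_neg_of_mul_neg_at_root a d b f ha hb s hξ hrootξ hneg
  have h2 := minor_pos_of_mul_pos_at_root a d b f ha hb s hη hrootη hpos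
  have hA : 0 < a (s + 1) * a (s + 2) := mul_pos (ha _) (ha _)
  have hB : 0 < b (s + 1) ^ 2 := by have := hb (s + 1); positivity
  exact lt_of_twoTerm_neg_pos hA hB hξ hη h1 h2

end StaticTridiagonalRealCut

end Summit.ValiantsHypothesis.ValiantsHypothesis.Theorems.KPlusLogSqLaw
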